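import Summits.PneNP.PneNP.Theorems.NegLimitedGapPMScheme
import Summits.PneNP.PneNP.Theorems.NegLimitedBiasedMatchingSunflower

/-!
# Route NegLimited — the cross-cut measure, few MATCHING minterms, positive errors (rung F-N1/p3, line r7-crosscut, files C2/C3)

The perfect-matching instance of the `μ`-closure engine (`NegLimitedMonotoneClosureW.lean`,
`NegLimitedGapPMScheme.lean`), cell record HOME/pnp-ideate-p3/ROUND-7.md §4 (rows C2, C3):

* `crossMeasure p` — the law of the cross-cut graph `crossGraph W`, `W ∼ μ_p` on the `2m` vertices,
  as a weight on the supports `U ⊆ Edge m` (`prW_crossMeasure`: `Pr_μ[E] = Pr_W[E(crossGraph W)]`;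
  total mass `1`; edge marginals `≤ 2p`);
* `SunflowerBound c₀` — the biased Matching Sunflower Lemma with an explicit constant
  (`BiasedMatchingSunflower ↔ ∃ c₀ > 0, SunflowerBound c₀`);
* `card_matching_minimals_lt` — **few MATCHING minterms** (CKR Lemma 2.11 for this measure): a
  `crossMeasure p`-closed up-set has `< (c₀ ℓ log²(ℓ/ε)/p²)^ℓ` minimal members that are
  `ℓ`-matchings, `1 ≤ ℓ ≤ c` (else the sunflower's core enters the family by closedness and kills the
  minimality of two distinct members);
* `sum_perm_lost_le` / `sum_lostSupW_le` / `sum_lostInfW_le` — the POSITIVE per-gate errors for the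
  uniform perfect matching `permGraph σ` (only matching minterms are ever charged: a minterm inside a
  perfect matching is a matching), and `sum_perm_mem_le` — CKR Lemma 2.17 (an approximator `≢ 1`
  accepts few perfect matchings).
-/

set_option linter.dupNamespace false -- `Summit.PneNP.PneNP.…`: summit = sub-problem name (D-0017 single-conjunct layout)

namespace Summit.PneNP.PneNP.Theorems.NegLimitedGapPM

open Finset Literature.Computability.Complexity Literature.Computability.Complexity.Razborov
  Literature.Computability.Complexity.CKR Literature.Computability.Complexity.PerfectMatching
open Literature.Combinatorics.SetFamily (finsetEquivFun biasedWeight biasedWeight_nonneg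
  sum_biasedWeight sum_biasedWeight_filter_subset)

variable {m : ℕ}

/-! ### The cross-cut measure on the supports -/

/-- The law of `crossGraph W` for `W ∼ μ_p`, as a weight on edge sets. -/
noncomputable def crossMeasure (p : ℝ) (U : Finset (Edge m)) : ℝ :=
  ∑ W ∈ univ.filter (fun W : Finset (Vtx m) => crossGraph W = U), biasedWeight p W

/-- The cross-cut weights are nonnegative for `p ∈ [0,1]`. -/
theorem crossMeasure_nonneg {p : ℝ} (hp0 : 0 ≤ p) (hp1 : p ≤ 1) (U : Finset (Edge m)) :
    0 ≤ crossMeasure p U :=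
  sum_nonneg fun W _ => biasedWeight_nonneg hp0 hp1 W

/-- **Push-forward**: `Pr_{crossMeasure p}[E] = Pr_{W ∼ μ_p}[E(crossGraph W)]`. -/
theorem prW_crossMeasure (p : ℝ) (E : Finset (Edge m) → Prop) [DecidablePred E] :
    prW (crossMeasure (m := m) p) E =
      ∑ W ∈ univ.filter (fun W : Finset (Vtx m) => E (crossGraph W)), biasedWeight p W := by
  unfold prW crossMeasure
  rw [← sum_fiberwise_of_maps_to (s := univ.filter fun W : Finset (Vtx m) => E (crossGraph W))
    (t := univ.filter E) (g := fun W => crossGraph W)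
    (fun W hW => mem_filter.2 ⟨mem_univ _, (mem_filter.1 hW).2⟩)]
  refine sum_congr rfl fun U hU => sum_congr ?_ fun _ _ => rfl
  ext W
  simp only [mem_filter, mem_univ, true_and]
  constructor
  · intro h; exact ⟨h ▸ (mem_filter.1 hU).2, h⟩
  · exact fun h => h.2

/-- Total mass `1`. -/
theorem sum_crossMeasure (p : ℝ) : ∑ U, crossMeasure (m := m) p U = 1 := by
  have h := prW_crossMeasure (m := m) p (fun _ => True)
  unfold prW at h
  rw [filter_true_of_mem (fun _ _ => trivial), filter_true_of_mem (fun _ _ => trivial),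
    sum_biasedWeight] at h
  exact h

/-- **Edge marginals**: `Pr[e ∈ crossGraph W] ≤ Pr[u ∈ W] + Pr[v ∈ W] = 2p` (`p ≥ 0`, `p ≤ 1`). -/
theorem prW_crossMeasure_mem_le {p : ℝ} (hp0 : 0 ≤ p) (hp1 : p ≤ 1) (e : Edge m) :
    prW (crossMeasure (m := m) p) (fun U : Finset (Edge m) => e ∈ U) ≤ 2 * p := by
  rw [prW_crossMeasure]
  have hu := sum_biasedWeight_filter_subset (α := Vtx m) p {Sum.inl e.1}
  have hv := sum_biasedWeight_filter_subset (α := Vtx m) p {Sum.inr e.2}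
  rw [card_singleton, pow_one] at hu hv
  simp only [singleton_subset_iff] at hu hv
  have hsub : (univ.filter fun W : Finset (Vtx m) => e ∈ crossGraph W) ⊆
      (univ.filter fun W : Finset (Vtx m) => (Sum.inl e.1 : Vtx m) ∈ W) ∪
        univ.filter fun W : Finset (Vtx m) => (Sum.inr e.2 : Vtx m) ∈ W := by
    intro W hW
    have h := (mem_filter.1 hW).2
    rw [mem_crossGraph] at h
    rw [mem_union, mem_filter, mem_filter]
    by_cases h1 : (Sum.inl e.1 : Vtx m) ∈ W
    · exact Or.inl ⟨mem_univ _, h1⟩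
    · right; refine ⟨mem_univ _, ?_⟩
      by_contra h2
      exact h (iff_of_false h1 h2)
  calc ∑ W ∈ univ.filter (fun W : Finset (Vtx m) => e ∈ crossGraph W), biasedWeight p W
      ≤ ∑ W ∈ (univ.filter fun W : Finset (Vtx m) => (Sum.inl e.1 : Vtx m) ∈ W) ∪
          univ.filter (fun W : Finset (Vtx m) => (Sum.inr e.2 : Vtx m) ∈ W), biasedWeight p W :=
        sum_le_sum_of_subset_of_nonneg hsub fun W _ _ => biasedWeight_nonneg hp0 hp1 W
    _ ≤ ∑ W ∈ univ.filter (fun W : Finset (Vtx m) => (Sum.inl e.1 : Vtx m) ∈ W), biasedWeight p W +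
          ∑ W ∈ univ.filter (fun W : Finset (Vtx m) => (Sum.inr e.2 : Vtx m) ∈ W),
            biasedWeight p W :=
        ApproxScheme.sum_union_le_of_nonneg (fun W => biasedWeight_nonneg hp0 hp1 W) _ _
    _ = 2 * p := by rw [hu, hv]; ring

/-! ### Few matching minterms of a closed family -/

/-- The biased Matching Sunflower Lemma with an explicit constant `c₀`. -/
def SunflowerBound (c₀ : ℝ) : Prop :=
  ∀ (m ℓ : ℕ) (p ε : ℝ), 1 ≤ ℓ → 0 < p → p ≤ 1 / 2 → 0 < ε → ε ≤ 1 / 2 →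
    ∀ 𝓕 : Finset (Finset (Edge m)), (∀ M ∈ 𝓕, IsMatching M ∧ #M = ℓ) →
      (c₀ * ℓ * Real.log (ℓ / ε) ^ 2 / p ^ 2) ^ ℓ ≤ (#𝓕 : ℝ) →
        ∃ 𝓕' ⊆ 𝓕, IsCrossMatchingSunflower (m := m) p ε 𝓕'

/-- `BiasedMatchingSunflower` provides a constant for `SunflowerBound`. -/
theorem exists_sunflowerBound (h : BiasedMatchingSunflower) : ∃ c₀ : ℝ, 0 < c₀ ∧ SunflowerBound c₀ :=
  h

/-- The sunflower threshold `(c₀ ℓ log²(ℓ/ε) / p²)^ℓ`. -/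
noncomputable def thr (c₀ p ε : ℝ) (ℓ : ℕ) : ℝ := (c₀ * ℓ * Real.log (ℓ / ε) ^ 2 / p ^ 2) ^ ℓ

/-- **Few MATCHING minterms** (CKR Lemma 2.11 for the cross-cut measure, via the biased Matching
Sunflower Lemma): a `crossMeasure p`-closed up-set `𝒯` (parameters `c`, `ε`) has fewer than
`(c₀ ℓ log²(ℓ/ε)/p²)^ℓ` minimal members that are `ℓ`-matchings, for `1 ≤ ℓ ≤ c` — otherwise these
minterms contain an `ε`-matching sunflower `𝓕'` for the measure, whose core `D` (`|D| < ℓ ≤ c`)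
satisfies `Pr_W[D ∪ crossGraph W ∈ 𝒯] > 1 - ε`, hence `D ∈ 𝒯` by closedness, contradicting the
minimality of the (at least two, distinct) members of `𝓕'`. -/
theorem card_matching_minimals_lt {c₀ p ε : ℝ} (hSF : SunflowerBound c₀) (hp0 : 0 < p)
    (hp1 : p ≤ 1 / 2) (hε0 : 0 < ε) (hε1 : ε ≤ 1 / 2) {c : ℕ} {𝒯 : Finset (Finset (Edge m))}
    (hup : IsUpperSet (𝒯 : Set (Finset (Edge m)))) (hcl : IsClosedFamW (crossMeasure p) c ε 𝒯)
    {ℓ : ℕ} (hℓ1 : 1 ≤ ℓ) (hℓc : ℓ ≤ c) :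
    (#((minimals 𝒯).filter fun A => IsMatching A ∧ #A = ℓ) : ℝ) < thr c₀ p ε ℓ := by
  by_contra hge
  rw [not_lt] at hge
  set F := (minimals 𝒯).filter fun A => IsMatching A ∧ #A = ℓ with hF
  have hFdef : ∀ M ∈ F, IsMatching M ∧ #M = ℓ := fun M hM => (mem_filter.1 hM).2
  obtain ⟨𝓕', h𝓕'F, h2, hrob⟩ := hSF m ℓ p ε hℓ1 hp0 hp1 hε0 hε1 F hFdef hge
  set D := PerfectMatching.core 𝓕' with hD
  -- two distinct members
  obtain ⟨M₁, hM₁, M₂, hM₂, hne⟩ := one_lt_card.1 (by omega : 1 < #𝓕')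
  have hM₁F := h𝓕'F hM₁
  have hM₂F := h𝓕'F hM₂
  have hDc : #D ≤ c :=
    ((card_le_card (core_subset hM₁)).trans (hFdef M₁ hM₁F).2.le).trans hℓc
  -- the core is forced into `𝒯` by closedness
  have hDT : D ∈ 𝒯 := by
    refine hcl D hDc (hrob.trans_le ?_)
    rw [prW_crossMeasure]
    refine sum_le_sum_of_subset_of_nonneg (fun W hW => ?_)
      fun W _ _ => biasedWeight_nonneg hp0.le (by linarith) W
    obtain ⟨M, hM, hMW⟩ := (mem_filter.1 hW).2
    refine mem_filter.2 ⟨mem_univ _, ?_⟩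
    have hMT : M ∈ 𝒯 := minimals_subset _ (mem_filter.1 (h𝓕'F hM)).1
    refine hup (show M ⊆ D ∪ crossGraph W from fun e he => ?_) hMT
    by_cases heD : e ∈ D
    · exact mem_union_left _ heD
    · exact mem_union_right _ (hMW (mem_sdiff.2 ⟨he, heD⟩))
  -- contradiction with minimality
  have h1 : D = M₁ := (mem_minimals.1 (mem_filter.1 hM₁F).1).2 D hDT (core_subset hM₁)
  have h2' : D = M₂ := (mem_minimals.1 (mem_filter.1 hM₂F).1).2 D hDT (core_subset hM₂)
  exact hne (h1.symm.trans h2')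

/-! ### Errors on the positive test inputs: uniform perfect matchings -/

/-- The input of a perfect matching, by support. -/
theorem finsetEquivFun_permGraph (σ : Equiv.Perm (Fin m)) :
    finsetEquivFun (permGraph σ) = permInput σ := by
  funext e
  simp [permInput, Literature.Combinatorics.SetFamily.finsetEquivFun]

/-- **Probability that the random perfect matching passes through the matching minterms of sizes in
`L ⊆ [1, c]`**: `∑_{A matching minterm, |A| ∈ L} Pr_σ[A ⊆ permGraph σ] ≤ ∑_{ℓ ∈ L} thr(ℓ) (m-ℓ)!/m!`. -/
theorem sum_card_filter_supset_permGraph_le {c₀ p ε : ℝ} (hSF : SunflowerBound c₀) (hc0 : 0 ≤ c₀)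
    (hp0 : 0 < p) (hp1 : p ≤ 1 / 2) (hε0 : 0 < ε) (hε1 : ε ≤ 1 / 2) {c : ℕ}
    {𝒯 : Finset (Finset (Edge m))} (hup : IsUpperSet (𝒯 : Set (Finset (Edge m))))
    (hcl : IsClosedFamW (crossMeasure p) c ε 𝒯) (L : Finset ℕ) (hL : ∀ ℓ ∈ L, 1 ≤ ℓ ∧ ℓ ≤ c) :
    ∑ A ∈ (minimals 𝒯).filter (fun A => IsMatching A ∧ #A ∈ L),
        (#(univ.filter fun σ : Equiv.Perm (Fin m) => A ⊆ permGraph σ) : ℝ) / m.factorial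
      ≤ ∑ ℓ ∈ L, thr c₀ p ε ℓ * ((m - ℓ).factorial / m.factorial) := by
  have hmf : (0 : ℝ) < m.factorial := by exact_mod_cast Nat.factorial_pos m
  rw [← sum_fiberwise_of_maps_to (s := (minimals 𝒯).filter fun A => IsMatching A ∧ #A ∈ L) (t := L)
    (g := card) fun A hA => (mem_filter.1 hA).2.2]
  refine sum_le_sum fun ℓ hℓ => ?_
  obtain ⟨hℓ1, hℓc⟩ := hL ℓ hℓ
  have hset : ((minimals 𝒯).filter fun A => IsMatching A ∧ #A ∈ L).filter (fun A => #A = ℓ)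
      = (minimals 𝒯).filter fun A => IsMatching A ∧ #A = ℓ := by
    ext A
    simp only [mem_filter]
    constructor
    · rintro ⟨⟨h1, h2, -⟩, h3⟩; exact ⟨h1, h2, h3⟩
    · rintro ⟨h1, h2, h3⟩; exact ⟨⟨h1, h2, h3 ▸ hℓ⟩, h3⟩
  have hterm : ∀ A ∈ ((minimals 𝒯).filter fun A => IsMatching A ∧ #A ∈ L).filter (fun A => #A = ℓ),
      (#(univ.filter fun σ : Equiv.Perm (Fin m) => A ⊆ permGraph σ) : ℝ) / m.factorial
        ≤ (m - ℓ).factorial / m.factorial := by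
    intro A hA
    rw [hset] at hA
    obtain ⟨-, hAm, hAℓ⟩ := mem_filter.1 hA
    refine div_le_div_of_nonneg_right ?_ hmf.le
    rw [← hAℓ]
    exact_mod_cast card_filter_supset_permGraph_le hAm
  have hcount := card_matching_minimals_lt (m := m) hSF hp0 hp1 hε0 hε1 hup hcl hℓ1 hℓc
  have hthr0 : 0 ≤ thr c₀ p ε ℓ := by
    unfold thr
    have : 0 ≤ Real.log (ℓ / ε) ^ 2 := sq_nonneg _
    positivity
  calc ∑ A ∈ ((minimals 𝒯).filter fun A => IsMatching A ∧ #A ∈ L).filter (fun A => #A = ℓ),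
        (#(univ.filter fun σ : Equiv.Perm (Fin m) => A ⊆ permGraph σ) : ℝ) / m.factorial
      ≤ ∑ A ∈ ((minimals 𝒯).filter fun A => IsMatching A ∧ #A ∈ L).filter (fun A => #A = ℓ),
          ((m - ℓ).factorial / m.factorial : ℝ) := sum_le_sum hterm
    _ = #((minimals 𝒯).filter fun A => IsMatching A ∧ #A = ℓ) * ((m - ℓ).factorial / m.factorial : ℝ) := by
        rw [sum_const, nsmul_eq_mul, hset]
    _ ≤ thr c₀ p ε ℓ * ((m - ℓ).factorial / m.factorial) :=
        mul_le_mul_of_nonneg_right hcount.le (by positivity)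

/-- **Approximation loses little positive weight** (CKR Lemma 2.16 + few matching minterms): if the
up-set `ℋ` has all minterms of size `≤ c`, the perfect matchings `σ` with `permGraph σ ∈ ℋ` but
`permGraph σ ∉ trim(cl_μ(ℋ))` have probability `≤ ∑_{c/2 < ℓ ≤ c} thr(ℓ) (m-ℓ)!/m!` (a minterm of
the closure inside `permGraph σ` is a MATCHING of size in `(c/2, c]`). -/
theorem sum_perm_lost_le {c₀ p ε : ℝ} (hSF : SunflowerBound c₀) (hc0 : 0 ≤ c₀) (hp0 : 0 < p)
    (hp1 : p ≤ 1 / 2) (hε0 : 0 < ε) (hε1 : ε ≤ 1 / 2) {c : ℕ} {ℋ : Finset (Finset (Edge m))}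
    (hℋ : ∀ A ∈ minimals ℋ, #A ≤ c) :
    ∑ _σ ∈ univ.filter (fun σ : Equiv.Perm (Fin m) =>
        permGraph σ ∈ ℋ ∧ permGraph σ ∉ trim c (closureW (crossMeasure p) c ε ℋ)),
        (1 / m.factorial : ℝ)
      ≤ ∑ ℓ ∈ Ioc (c / 2) c, thr c₀ p ε ℓ * ((m - ℓ).factorial / m.factorial) := by
  have hmf : (0 : ℝ) < m.factorial := by exact_mod_cast Nat.factorial_pos m
  have hμ0 : ∀ U : Finset (Edge m), 0 ≤ crossMeasure p U :=
    fun U => crossMeasure_nonneg hp0.le (by linarith) U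
  set 𝒯 := closureW (crossMeasure (m := m) p) c ε ℋ with h𝒯
  set 𝓜 := (minimals 𝒯).filter fun A => IsMatching A ∧ #A ∈ Ioc (c / 2) c with h𝓜
  have hcover : (univ.filter fun σ : Equiv.Perm (Fin m) => permGraph σ ∈ ℋ ∧ permGraph σ ∉ trim c 𝒯)
      ⊆ 𝓜.biUnion fun A => univ.filter fun σ : Equiv.Perm (Fin m) => A ⊆ permGraph σ := by
    intro σ hσ
    obtain ⟨h1, h2⟩ := (mem_filter.1 hσ).2
    obtain ⟨A, hA, hgt, hle, hAσ⟩ := exists_minimal_of_mem_of_not_mem_trim_closureW hℋ h1 h2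
    exact mem_biUnion.2 ⟨A, mem_filter.2 ⟨hA, (isMatching_permGraph σ).subset hAσ,
      mem_Ioc.2 ⟨hgt, hle⟩⟩, mem_filter.2 ⟨mem_univ _, hAσ⟩⟩
  have hsizes : ∀ ℓ ∈ Ioc (c / 2) c, 1 ≤ ℓ ∧ ℓ ≤ c := fun ℓ hℓ => by
    rw [mem_Ioc] at hℓ; omega
  have hmain := sum_card_filter_supset_permGraph_le (m := m) hSF hc0 hp0 hp1 hε0 hε1
    (isUpperSet_closureW ℋ) (isClosedFamW_closureW hμ0 ℋ) (Ioc (c / 2) c) hsizes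
  calc ∑ _σ ∈ univ.filter (fun σ : Equiv.Perm (Fin m) => permGraph σ ∈ ℋ ∧ permGraph σ ∉ trim c 𝒯),
        (1 / m.factorial : ℝ)
      = #(univ.filter fun σ : Equiv.Perm (Fin m) => permGraph σ ∈ ℋ ∧ permGraph σ ∉ trim c 𝒯)
          * (1 / m.factorial : ℝ) := by rw [sum_const, nsmul_eq_mul]
    _ ≤ (∑ A ∈ 𝓜, (#(univ.filter fun σ : Equiv.Perm (Fin m) => A ⊆ permGraph σ) : ℝ))
          * (1 / m.factorial) := by
        refine mul_le_mul_of_nonneg_right ?_ (by positivity)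
        exact_mod_cast (card_le_card hcover).trans card_biUnion_le
    _ = ∑ A ∈ 𝓜, (#(univ.filter fun σ : Equiv.Perm (Fin m) => A ⊆ permGraph σ) : ℝ) / m.factorial := by
        rw [sum_mul]; exact sum_congr rfl fun A _ => by ring
    _ ≤ _ := hmain

/-- **CKR Lemma 2.17 for perfect matchings**: an approximator `𝒜` not containing `∅` (i.e. `≢ 1`)
accepts the uniform perfect matching with probability `≤ ∑_{1 ≤ ℓ ≤ c/2} thr(ℓ) (m-ℓ)!/m!`. -/
theorem sum_perm_mem_le {c₀ p ε : ℝ} (hSF : SunflowerBound c₀) (hc0 : 0 ≤ c₀) (hp0 : 0 < p)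
    (hp1 : p ≤ 1 / 2) (hε0 : 0 < ε) (hε1 : ε ≤ 1 / 2) {c : ℕ} {𝒜 : Finset (Finset (Edge m))}
    (h𝒜 : IsApproxW (crossMeasure p) c ε 𝒜) (h0 : ∅ ∉ 𝒜) :
    ∑ _σ ∈ univ.filter (fun σ : Equiv.Perm (Fin m) => permGraph σ ∈ 𝒜), (1 / m.factorial : ℝ)
      ≤ ∑ ℓ ∈ Icc 1 (c / 2), thr c₀ p ε ℓ * ((m - ℓ).factorial / m.factorial) := by
  have hmf : (0 : ℝ) < m.factorial := by exact_mod_cast Nat.factorial_pos m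
  obtain ⟨𝒯, hup, hcl, rfl⟩ := h𝒜
  set 𝓜 := (minimals 𝒯).filter fun A => IsMatching A ∧ #A ∈ Icc 1 (c / 2) with h𝓜
  have hcover : (univ.filter fun σ : Equiv.Perm (Fin m) => permGraph σ ∈ trim c 𝒯)
      ⊆ 𝓜.biUnion fun A => univ.filter fun σ : Equiv.Perm (Fin m) => A ⊆ permGraph σ := by
    intro σ hσ
    obtain ⟨A, hA, h1, h2, hAσ⟩ := exists_minimal_of_mem_trim h0 (mem_filter.1 hσ).2
    exact mem_biUnion.2 ⟨A, mem_filter.2 ⟨hA, (isMatching_permGraph σ).subset hAσ,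
      mem_Icc.2 ⟨h1, h2⟩⟩, mem_filter.2 ⟨mem_univ _, hAσ⟩⟩
  have hsizes : ∀ ℓ ∈ Icc 1 (c / 2), 1 ≤ ℓ ∧ ℓ ≤ c := fun ℓ hℓ => by
    rw [mem_Icc] at hℓ; omega
  have hmain := sum_card_filter_supset_permGraph_le (m := m) hSF hc0 hp0 hp1 hε0 hε1 hup hcl
    (Icc 1 (c / 2)) hsizes
  calc ∑ _σ ∈ univ.filter (fun σ : Equiv.Perm (Fin m) => permGraph σ ∈ trim c 𝒯), (1 / m.factorial : ℝ)
      = #(univ.filter fun σ : Equiv.Perm (Fin m) => permGraph σ ∈ trim c 𝒯) * (1 / m.factorial : ℝ) := by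
        rw [sum_const, nsmul_eq_mul]
    _ ≤ (∑ A ∈ 𝓜, (#(univ.filter fun σ : Equiv.Perm (Fin m) => A ⊆ permGraph σ) : ℝ))
          * (1 / m.factorial) := by
        refine mul_le_mul_of_nonneg_right ?_ (by positivity)
        exact_mod_cast (card_le_card hcover).trans card_biUnion_le
    _ = ∑ A ∈ 𝓜, (#(univ.filter fun σ : Equiv.Perm (Fin m) => A ⊆ permGraph σ) : ℝ) / m.factorial := by
        rw [sum_mul]; exact sum_congr rfl fun A _ => by ring
    _ ≤ _ := hmain

end Summit.PneNP.PneNP.Theorems.NegLimitedGapPM
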